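import Summits.CriticalPhenomena.PercolationContinuityZ3.Theorems.Transplant.PlanarCells2TDefs
import HarnessLib

/-!
(R-40) SUCCESSOR `…T` (hp-8 g42, 2026-08-23; ruling p3-g16 06:23:56Z, J18): the twin of `PlanarCells2SFar` over the PER-AXIS creep cap `PCells2T` (PlanarCells2TDefs:
`c i ≤ r (oth i)` instead of the uniform `c i ≤ cmax ≤ r j`); statements and proofs VERBATIM with `PCells2S ↦ PCells2T` (+ the renames of record of the T layer below it);
the only mathematical touch points are the places that read the cap, which only ever need the cross form `c (oth j) ≤ r j` (listed in the lane line of this file's landing).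
NO landed file is edited; `PlanarCells2SFar` stays valid (and is an instance of this file through `PCells2S.toT`). NON-VACUITY: inherited verbatim from `PlanarCells2SFar` (same witness line).

# N2 (frames-only node `SamePDropOfSkeletonFrm₁`, OPEN), (R-27): THE FAR REGIONS OF THE STAGGERED CELLS FOLLOW THE NEIGHBOUR —
# `PCells2T.EfarS v δ := Btw v δ ∪ Q (v + stepVec δ)` (and the narrowed `EfarNS`, `EfarN₂S` over the neighbour's box narrowed ACROSS, `QNS`),
# so that N1's set identities `Efar = Btw ∪ Q′`, `EfarN = BtwN ∪ Q′⁻` hold BY CONSTRUCTION under the creep; the pair separations `Q v ⟂ EfarS v δ`,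
# `Q (v+δ) ⟂ Btw v δ` as two one-box facts; `M (v + δ) ⊆ QNS ⊆ EfarS/NS/N₂S`.  Pure `Site 2`.

builds on p205010 (kernel theorem, internal audit signed; external expert review pending) — nothing in this file uses p205010; nothing here is a
claim about the open node `SamePDropOfSkeletonFrm₁`.
Lane `prim-bschramm`, seat `prim-bschramm-p5` (gen 15); helper file (`--supports stmt-CriticalPhenomena-4575`).
RULING (R-27) (design owner p3-g15, lane INBOX 2026-08-22T20:44:36Z, on stmt-g19's GEOM-REBASE-PRECENSUS 20:43:50Z): under the creep the one-box far
region `PCells2T.Efar` (PlanarCells2SDefs :161, kept for the record) no longer contains `Q (v + stepVec δ)` (whose centre is displaced across by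
`sgOf δ · c δ.1`, `cenS_add_stepVec_oth`); the far block is therefore DEFINED as the union of the between-box and the neighbour's box — every
`cellGeomSG₂` field statement keeps its form, `Efar_subset_Btw_union_Q` becomes `subset_rfl`, and each separation against the far region is the pair
of a `Btw`-fact and a `Q`-fact.  The Contain/Sep/SepInf/EfarN2 ports over these names are the WAVE-1 Geom typer's (order of record §D).
* §1 `QNS v δ m` (the neighbour's `Q` narrowed by `m` across), `mem_QNS_iff`, `QNS_subset_Q`, `QNS_mono`, `M_add_stepVec_subset_QNS` (`m ≤ 2r⊥`);
* §2 `BtwN₂`, **`EfarS`**, **`EfarNS`**, **`EfarN₂S`**, `EfarS_eq_Ewv`, `EfarS_subset_Btw_union_Q` / `EfarNS_subset_BtwN_union_Q` (by construction),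
  `mem_EfarS_of_mem_Q_add`, `BtwN₂_subset_BtwN`, `BtwN_subset_Btw'`, `EfarN₂S_subset_EfarNS`, `EfarNS_subset_EfarS`, `M_add_stepVec_subset_EfarS/NS/N₂S`;
* §3 two-box separations for the pairs the decomposition uses: `Q_disjoint_Btw_self`, `Q_add_disjoint_Btw`, `Q_disjoint_Q_add`, **`Q_disjoint_EfarS`**.
[cite: KozmaNitzan2024, §4 pp. 25–26 (Q_v, E_{v,x}, E^far_{v,x})]
-/

noncomputable section

namespace Summit.CriticalPhenomena.PercolationContinuityZ3.Theorems

namespace Transplant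

open Literature.Probability.Percolation Literature.Probability.LatticeModels SimpleGraph GadgetSystem Contour
open Literature.Probability.Percolation.KozmaNitzan
open Literature.Probability.Percolation.KozmaNitzan.Cells (oth oth_ne sgOf sgOf_sign stepVec_apply_fst stepVec_apply_oth eq_oth_of_ne oth_oth)
open PCells (mem_psBox_iff)

namespace PCells2T

variable (P : PCells2T)

/-! ## §1 The neighbour's box, narrowed across -/

/-- **The neighbour's box narrowed by `m` ACROSS**: `cenS (v + δ) + [−5r∥, 5r∥] × [−(5r⊥ − m), 5r⊥ − m]` as a signed box on the step axis.
[cite: KozmaNitzan2024, §4 p. 26 (Q_x)] -/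
def QNS (v : Site 2) (δ : MDir) (m : ℕ) : Finset (Site 2) :=
  sBox δ.1 (sgOf δ) (P.cenS (v + stepVec δ)) (-(5 * (P.r δ.1 : ℤ))) (5 * (P.r δ.1 : ℤ)) (5 * (P.r (oth δ.1) : ℤ) - m)

variable {P}

/-- Membership in `QNS`. [folklore] -/
theorem mem_QNS_iff {v : Site 2} {δ : MDir} {m : ℕ} {t : Site 2} :
    t ∈ (P : PCells2T).QNS v δ m ↔
      (-(5 * (P.r δ.1 : ℤ)) ≤ sgOf δ * (t δ.1 - P.cenS (v + stepVec δ) δ.1) ∧ sgOf δ * (t δ.1 - P.cenS (v + stepVec δ) δ.1) ≤ 5 * (P.r δ.1 : ℤ)) ∧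
      (P.cenS (v + stepVec δ) (oth δ.1) - (5 * (P.r (oth δ.1) : ℤ) - m) ≤ t (oth δ.1) ∧
        t (oth δ.1) ≤ P.cenS (v + stepVec δ) (oth δ.1) + (5 * (P.r (oth δ.1) : ℤ) - m)) :=
  mem_psBox_iff

/-- `QNS ⊆ Q (v + δ)`. [folklore] -/
theorem QNS_subset_Q (v : Site 2) (δ : MDir) (m : ℕ) : (P : PCells2T).QNS v δ m ⊆ P.Q (v + stepVec δ) := by
  intro t ht
  rw [mem_QNS_iff] at ht
  obtain ⟨⟨h1, h2⟩, h3, h4⟩ := ht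
  rw [Q, mem_aboxS_iff]
  intro i
  have hm : (0 : ℤ) ≤ m := Int.natCast_nonneg m
  by_cases hi : i = δ.1
  · subst hi
    push_cast
    rcases sgOf_sign δ with hs | hs <;> rw [hs] at h1 h2 <;> constructor <;> linarith
  · rw [eq_oth_of_ne hi]; push_cast; constructor <;> linarith

/-- `QNS` shrinks as `m` grows. [folklore] -/
theorem QNS_mono (v : Site 2) (δ : MDir) {m m' : ℕ} (h : m' ≤ m) : (P : PCells2T).QNS v δ m ⊆ P.QNS v δ m' := by
  intro t ht
  rw [mem_QNS_iff] at ht ⊢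
  obtain ⟨h12, h3, h4⟩ := ht
  have hm : (m' : ℤ) ≤ m := by exact_mod_cast h
  exact ⟨h12, by linarith, by linarith⟩

/-- **The neighbour's cube lies in its narrowed box** when `m ≤ 2r⊥`. [cite: KozmaNitzan2024, §4 p. 26 (M_x ⊆ Q_x)] -/
theorem M_add_stepVec_subset_QNS (v : Site 2) (δ : MDir) {m : ℕ} (hm : (m : ℤ) ≤ 2 * ((P : PCells2T).r (oth δ.1) : ℤ)) :
    P.M (v + stepVec δ) ⊆ P.QNS v δ m := by
  intro t ht
  rw [M, mem_aboxS_iff] at ht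
  have h1 := ht δ.1; have h2 := ht (oth δ.1)
  push_cast at h1 h2
  rw [mem_QNS_iff]
  refine ⟨?_, by linarith [h2.1], by linarith [h2.2]⟩
  rcases sgOf_sign δ with hs | hs <;> rw [hs] <;> constructor <;> linarith [h1.1, h1.2]

variable (P)

/-! ## §2 The far regions that follow the neighbour -/

/-- The twice-narrowed between-box `cenS v + {5r∥ < σ x_a < 15r∥} × [−(5r⊥−2), 5r⊥−2]`. [cite: KozmaNitzan2024, §4 p. 26 (E_{v,x})] -/
def BtwN₂ (v : Site 2) (δ : MDir) : Finset (Site 2) :=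
  sBox δ.1 (sgOf δ) (P.cenS v) (5 * P.r δ.1 + 1) (15 * P.r δ.1 - 1) (5 * (P.r (oth δ.1) : ℤ) - 2)

/-- **THE FAR REGION OF THE STAGGERED CELLS** ((R-27)): `E^far_{v,x} := Btw v δ ∪ Q (v + stepVec δ)` — the between-box and the NEIGHBOUR's box (displaced
across by the creep). [cite: KozmaNitzan2024, §4 p. 26 (E_{v,x})] -/
def EfarS (v : Site 2) (δ : MDir) : Finset (Site 2) := P.Btw v δ ∪ P.Q (v + stepVec δ)

/-- The narrow far region ((R-27)): `BtwN ∪ (Q (v + δ) narrowed by 1 across)`. [cite: KozmaNitzan2024, §4 p. 26 (E_{v,x})] -/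
def EfarNS (v : Site 2) (δ : MDir) : Finset (Site 2) := P.BtwN v δ ∪ P.QNS v δ 1

/-- The twice-narrowed far region ((R-27)): `BtwN₂ ∪ (Q (v + δ) narrowed by 2 across)`. [cite: KozmaNitzan2024, §4 p. 26 (E_{v,x})] -/
def EfarN₂S (v : Site 2) (δ : MDir) : Finset (Site 2) := P.BtwN₂ v δ ∪ P.QNS v δ 2

/-- `EfarS` IS `Ewv` (PlanarCells2SDefs :165) — two names for the two roles. [folklore] -/
theorem EfarS_eq_Ewv (v : Site 2) (δ : MDir) : (P : PCells2T).EfarS v δ = P.Ewv v δ := rfl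

/-- N1's `Efar_subset_Btw_union_Q`, by construction. [folklore] -/
theorem EfarS_subset_Btw_union_Q (v : Site 2) (δ : MDir) : (P : PCells2T).EfarS v δ ⊆ P.Btw v δ ∪ P.Q (v + stepVec δ) := subset_rfl

/-- N1's `EfarN_subset_BtwN_union_Q`, by construction. [folklore] -/
theorem EfarNS_subset_BtwN_union_Q (v : Site 2) (δ : MDir) : (P : PCells2T).EfarNS v δ ⊆ P.BtwN v δ ∪ P.Q (v + stepVec δ) :=
  Finset.union_subset_union subset_rfl (QNS_subset_Q v δ 1)

/-- N1's `mem_Efar_of_mem_Q_add`, by construction. [folklore] -/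
theorem mem_EfarS_of_mem_Q_add {v : Site 2} {δ : MDir} {t : Site 2} (ht : t ∈ (P : PCells2T).Q (v + stepVec δ)) : t ∈ P.EfarS v δ :=
  Finset.mem_union_right _ ht

/-- `BtwN₂ ⊆ BtwN`. [folklore] -/
theorem BtwN₂_subset_BtwN (v : Site 2) (δ : MDir) : (P : PCells2T).BtwN₂ v δ ⊆ P.BtwN v δ := by
  intro t ht
  rw [BtwN₂, mem_psBox_iff] at ht
  rw [BtwN, mem_psBox_iff]
  obtain ⟨h12, h3, h4⟩ := ht
  exact ⟨h12, by linarith, by linarith⟩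

/-- `BtwN ⊆ Btw`. [folklore] -/
theorem BtwN_subset_Btw' (v : Site 2) (δ : MDir) : PCells2T.BtwN P v δ ⊆ PCells2T.Btw P v δ := by
  intro t ht
  rw [BtwN, mem_psBox_iff] at ht
  rw [Btw, mem_psBox_iff]
  obtain ⟨h12, h3, h4⟩ := ht
  exact ⟨h12, by linarith, by linarith⟩

/-- `EfarN₂S ⊆ EfarNS`. [folklore] -/
theorem EfarN₂S_subset_EfarNS (v : Site 2) (δ : MDir) : (P : PCells2T).EfarN₂S v δ ⊆ P.EfarNS v δ :=
  Finset.union_subset_union (P.BtwN₂_subset_BtwN v δ) (QNS_mono v δ (by norm_num))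

/-- `EfarNS ⊆ EfarS`. [folklore] -/
theorem EfarNS_subset_EfarS (v : Site 2) (δ : MDir) : (P : PCells2T).EfarNS v δ ⊆ P.EfarS v δ :=
  Finset.union_subset_union (P.BtwN_subset_Btw' v δ) (QNS_subset_Q v δ 1)

/-- **`M (v + δ) ⊆ EfarN₂S v δ`** (N1's `M_add_stepVec_subset_EfarN₂`). [cite: KozmaNitzan2024, §4 p. 26 (M_x ⊆ E^far_{v,x})] -/
theorem M_add_stepVec_subset_EfarN₂S (v : Site 2) (δ : MDir) : (P : PCells2T).M (v + stepVec δ) ⊆ P.EfarN₂S v δ := by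
  refine fun t ht => Finset.mem_union_right _ (M_add_stepVec_subset_QNS v δ ?_ ht)
  have := P.one_le_r (oth δ.1); push_cast; linarith [show (1 : ℤ) ≤ P.r (oth δ.1) by exact_mod_cast this]

/-- `M (v + δ) ⊆ EfarNS v δ`. [folklore] -/
theorem M_add_stepVec_subset_EfarNS (v : Site 2) (δ : MDir) : (P : PCells2T).M (v + stepVec δ) ⊆ P.EfarNS v δ :=
  (P.M_add_stepVec_subset_EfarN₂S v δ).trans (P.EfarN₂S_subset_EfarNS v δ)

/-- `M (v + δ) ⊆ EfarS v δ` (N1's `M_add_stepVec_subset_Efar`). [folklore] -/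
theorem M_add_stepVec_subset_EfarS (v : Site 2) (δ : MDir) : (P : PCells2T).M (v + stepVec δ) ⊆ P.EfarS v δ :=
  (P.M_add_stepVec_subset_EfarNS v δ).trans (P.EfarNS_subset_EfarS v δ)

/-! ## §3 Two-box separations for the pairs of the decomposition -/

/-- `Q v` and `Btw v δ` are disjoint (along: `≤ 5r∥` against `> 5r∥`). [cite: KozmaNitzan2024, §4 p. 26] -/
theorem Q_disjoint_Btw_self (v : Site 2) (δ : MDir) : Disjoint ((P : PCells2T).Q v) (P.Btw v δ) := by
  refine Finset.disjoint_left.2 fun t ht ht' => ?_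
  rw [Q, mem_aboxS_iff] at ht
  rw [Btw, mem_psBox_iff] at ht'
  have h1 := ht δ.1; push_cast at h1
  obtain ⟨⟨h2, _⟩, _⟩ := ht'
  rcases sgOf_sign δ with hs | hs <;> rw [hs] at h2 <;> linarith [h1.1, h1.2]

/-- `Q (v + δ)` and `Btw v δ` are disjoint (along: `≥ 15r∥` against `< 15r∥`, `cenS_add_stepVec_fst`). [cite: KozmaNitzan2024, §4 p. 26] -/
theorem Q_add_disjoint_Btw (v : Site 2) (δ : MDir) : Disjoint ((P : PCells2T).Q (v + stepVec δ)) (P.Btw v δ) := by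
  refine Finset.disjoint_left.2 fun t ht ht' => ?_
  rw [Q, mem_aboxS_iff] at ht
  rw [Btw, mem_psBox_iff] at ht'
  have h1 := ht δ.1; push_cast at h1
  rw [P.cenS_add_stepVec_fst v δ] at h1
  obtain ⟨⟨_, h2⟩, _⟩ := ht'
  rcases sgOf_sign δ with hs | hs <;> rw [hs] at h1 h2 <;> linarith [h1.1, h1.2]

/-- `Q v` and `Q (v + δ)` are disjoint (centres `≥ 19 r_j` apart in some coordinate, `cenS_sep'`). [cite: KozmaNitzan2024, §4 p. 26] -/
theorem Q_disjoint_Q_add (v : Site 2) (δ : MDir) : Disjoint ((P : PCells2T).Q v) (P.Q (v + stepVec δ)) := by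
  have hne : v ≠ v + stepVec δ := by
    intro h
    have h1 := congrArg (fun w : Site 2 => w δ.1) h
    simp only [Pi.add_apply, stepVec_apply_fst] at h1
    rcases sgOf_sign δ with hs | hs <;> rw [hs] at h1 <;> linarith
  obtain ⟨j, hj⟩ := P.cenS_sep' hne
  refine Finset.disjoint_left.2 fun t ht ht' => ?_
  rw [Q, mem_aboxS_iff] at ht ht'
  have h1 := ht j; have h2 := ht' j; push_cast at h1 h2
  have hr : (1 : ℤ) ≤ P.r j := by exact_mod_cast P.one_le_r j
  rcases le_abs.1 hj with h | h <;> linarith [h1.1, h1.2, h2.1, h2.2]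

/-- **`Q v` and `EfarS v δ` are disjoint** — the two one-box facts (N1's `Q_disjoint_Efar` at the pair it is used at). [cite: KozmaNitzan2024, §4 p. 26] -/
theorem Q_disjoint_EfarS (v : Site 2) (δ : MDir) : Disjoint ((P : PCells2T).Q v) (P.EfarS v δ) :=
  Finset.disjoint_union_right.2 ⟨P.Q_disjoint_Btw_self v δ, P.Q_disjoint_Q_add v δ⟩

end PCells2T

end Transplant

end Summit.CriticalPhenomena.PercolationContinuityZ3.Theorems

end
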